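import Mathlib
import HarnessLib.Audit
import Summits.PneNP.PneNP.Theorems.PstarChordBridgeForcing

/-!
# Rank-six vacuity of Case A, bridge lemmas: polar comparison, the evaluation identity, (★★) under the union cover (ROUND-24, memo §14.16–§14.18 STEP 1)

FRONTIER range-avoidance ladder, rung F-N3, ROUND 24 (cell `pnp-ideate`, planner memo `r24/CORE-BOUND-NOTES.md` §14.16–§14.18, CASE A MASTER PLAN of planner p3 g22,
STEP 1 "rank-six vacuity"; restricted-model proof complexity — nothing here bears on `P` versus `NP`).

The union configuration of Case A in bridge terms: well-formed liftable bridge data `B` (`PstarChordBridge`) whose first constraint is the reader `A₀ = (C₁, G₁, b₁)`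
and whose second is the shared constraint `w₂ = (C₂, G₂, b₂)`; the second reader `A₁ = (C₁′, G₁, b₁′)` has the same monomials and a linear part differing from
`C₁` off the XOR vertices (so `T₁` is a join for both), `B′ := {B with C₁ := C₁′, b₁ := b₁′}`.  Hun: no monomial of `G₁`, `G₂` touches a chord private; Case A:
`w₂` does not read the privates either.  This file supplies the mechanism-free lemmas for `PstarUnionRankSixEmpty`:

* `polar_union`, `freePolar_eq_polar_union`, `eq_of_polar_eq` — polar forms of output families add over disjoint unions and DETERMINE the family (AND pairs are
  pairwise distinct, `PstarPathRank.polar_basis`), `eq_inter_of_union_eq` — separating the core part;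
* `bit_gval_split` — the EVALUATION IDENTITY at an arbitrary assignment: `gval(C,G)(z) = free(x) + Σ_{C ∩ xverts} x + Σ_{C ∩ privs} x + Σ_{j∈T}(y_j + x_{p_j}x_{q_j})`
  (`x = bit ∘ z`), `sum_xverts_eq_pair_sum` — under the join condition the XOR reads are the pair sum of `T`;
* `wf_update` — `B′` is well formed; `forced_of_minimal`, `forced_of_cover` — **(★★) under the union cover**: every chord `c` has `u_c(a) = 1` at every `a` with
  `free₂ a = b₂` (`PstarChordSystem.star_star` in whichever of the two systems is chord-minimal at `c`; `u`, `free₂`, `b₂` are common to both);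
* `free₁_of_forced` — infeasibility at the all-ON state: on `Z(q)` the reader's state-free part is the constant `b₁ + R + 1`, `R = #(C₁ ∩ privs) mod 2`;
* `exists_solution_privs` — from a zero of `q` a genuine solution of `J₀ ∧ w₂` with all privates `1` (Lift + `setPriv`).
-/

set_option linter.dupNamespace false -- `Summit.PneNP.PneNP.…`: summit = sub-problem name (D-0017 single-conjunct layout)

open Finset Module Literature.Computability.Complexity
open scoped symmDiff
open Summit.PneNP.PneNP.Theorems.PstarFibrePolys (bit bit_injective)
open Summit.PneNP.PneNP.Theorems.PstarTyped (Typed)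
open Summit.PneNP.PneNP.Theorems.PstarSALevel (SimpleOverlap)
open Summit.PneNP.PneNP.Theorems.PstarGapOneAll (gval)
open Summit.PneNP.PneNP.Theorems.PstarGConstraint (bit_gval)
open Summit.PneNP.PneNP.Theorems.PstarXorElimination (pdeg)
open Summit.PneNP.PneNP.Theorems.PstarXCore (xverts)
open Summit.PneNP.PneNP.Theorems.PstarChordRepair (IsChord)
open Summit.PneNP.PneNP.Theorems.PstarProductRank (qform polar polar_apply)
open Summit.PneNP.PneNP.Theorems.PstarPathRank (AndAdj polar_basis andPair_ne)
open Summit.PneNP.PneNP.Theorems.PstarChordSystem (ChordSystem)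
open Summit.PneNP.PneNP.Theorems.PstarChordBridgeTools
open Summit.PneNP.PneNP.Theorems.PstarChordBridge
open Summit.PneNP.PneNP.Theorems.PstarChordBridgeForcing (freeMon freePolar coef_of_unread singleRead_of_untouched const_of_unread)

namespace Summit.PneNP.PneNP.Theorems.PstarUnionRankSixBridge

variable {n m : ℕ}

/-! ## Polar forms determine output families -/

/-- Polar forms add over disjoint unions of output families. -/
theorem polar_union {A A' : Finset (Fin m)} (h : Disjoint A A') (p q : Fin m → Fin n) :
    (polar (A ∪ A') p q : LinearMap.BilinForm (ZMod 2) (Fin n → ZMod 2)) = polar A p q + polar A' p q := by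
  refine LinearMap.ext₂ fun v w => ?_
  rw [LinearMap.add_apply, LinearMap.add_apply, polar_apply, polar_apply, polar_apply, sum_union h]

/-- The polar form of the state-free part is the polar form of ONE output family: the join together with the private-free monomials. -/
theorem freePolar_eq_polar_union (I : LocalMap 4 n m) {N T G : Finset (Fin m)} (h : Disjoint T (freeMon I N G)) :
    freePolar I N T G = polar (T ∪ freeMon I N G) (fun j => I.vars j 2) (fun j => I.vars j 3) := by
  unfold freePolar
  rw [polar_union h]

/-- **Output families with the same polar form are equal** (pure, simple overlaps: the polar form on basis vectors is the AND-adjacency indicator and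
distinct outputs have distinct AND pairs). -/
theorem eq_of_polar_eq (I : LocalMap 4 n m) (hI : I.IsPure xorAndPred) (hS : SimpleOverlap I) {D D' : Finset (Fin m)}
    (hpol : (polar D (fun j => I.vars j 2) (fun j => I.vars j 3) : LinearMap.BilinForm (ZMod 2) (Fin n → ZMod 2)) =
      polar D' (fun j => I.vars j 2) (fun j => I.vars j 3)) : D = D' := by
  classical
  have hadj : ∀ c d : Fin n, AndAdj I D c d ↔ AndAdj I D' c d := by
    intro c d
    have e := congrArg (fun C : LinearMap.BilinForm (ZMod 2) (Fin n → ZMod 2) => C (Pi.single c 1) (Pi.single d 1)) hpol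
    rw [polar_basis I hI hS D, polar_basis I hI hS D'] at e
    by_cases h1 : AndAdj I D c d <;> by_cases h2 : AndAdj I D' c d <;> simp only [h1, h2, if_true, if_false] at e ⊢
    · exact absurd e one_ne_zero
    · exact absurd e zero_ne_one
  -- membership transfers along AND pairs (as in `PstarChordBridgeForcing.eq_of_qform_eq`)
  have key : ∀ {D D' : Finset (Fin m)}, (∀ c d, AndAdj I D c d → AndAdj I D' c d) → D ⊆ D' := by
    intro D D' hDD' j hj
    obtain ⟨j', hj', hm⟩ := hDD' _ _ ⟨j, hj, Or.inl ⟨rfl, rfl⟩⟩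
    by_cases hjj : j = j'
    · rw [hjj]; exact hj'
    · exfalso
      refine andPair_ne I hI hS hjj ?_
      rcases hm with ⟨h2, h3⟩ | ⟨h2, h3⟩
      · exact Or.inl ⟨h2.symm, h3.symm⟩
      · exact Or.inr ⟨h3.symm, h2.symm⟩
  exact Subset.antisymm (key fun c d => (hadj c d).1) (key fun c d => (hadj c d).2)

/-- Separating the core part of two equal unions: `T ∪ A = T' ∪ A'` with `T, T' ⊆ J₀` and `A, A'` disjoint from `J₀` gives `T = T'`. -/
theorem eq_of_union_eq {J₀ T T' A A' : Finset (Fin m)} (hT : T ⊆ J₀) (hT' : T' ⊆ J₀) (hA : Disjoint A J₀) (hA' : Disjoint A' J₀)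
    (h : T ∪ A = T' ∪ A') : T = T' := by
  ext j
  constructor
  · intro hj
    have : j ∈ T' ∪ A' := h ▸ mem_union_left _ hj
    rcases mem_union.1 this with h' | h'
    · exact h'
    · exact absurd (hT hj) (disjoint_left.1 hA' h')
  · intro hj
    have : j ∈ T ∪ A := h.symm ▸ mem_union_left _ hj
    rcases mem_union.1 this with h' | h'
    · exact h'
    · exact absurd (hT' hj) (disjoint_left.1 hA h')

/-! ## The evaluation identity at an arbitrary assignment -/

/-- **The evaluation identity.**  For a G-constraint `(C, G)` none of whose monomials touches a private:
`gval(C,G)(z) = free(x) + Σ_{v ∈ C ∩ xverts F} x_v + Σ_{v ∈ C ∩ privs N} x_v + Σ_{j ∈ T} (y_j + x_{p_j} x_{q_j})` with `x = bit ∘ z`, for EVERY assignment `z`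
(no output needs to hold). -/
theorem bit_gval_split (I : LocalMap 4 n m) (hT : Typed I) (y : Fin m → Bool) (F N T : Finset (Fin m)) (C : Finset (Fin n)) (G : Finset (Fin m))
    (hG : ∀ g ∈ G, ¬ (I.vars g 2 ∈ privs I N ∨ I.vars g 3 ∈ privs I N)) (z : Fin n → Bool) :
    bit (gval I C G z) = free I y F N T C G (fun v => bit (z v))
      + ∑ v ∈ C.filter (fun v => v ∈ xverts I F), bit (z v) + ∑ v ∈ C.filter (fun v => v ∈ privs I N), bit (z v)
      + ∑ j ∈ T, (bit (y j) + bit (z (I.vars j 2)) * bit (z (I.vars j 3))) := by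
  classical
  unfold free
  rw [bit_gval, filter_true_of_mem hG]
  -- split the linear part three ways
  have h1 := (sum_filter_add_sum_filter_not C (fun v => v ∈ xverts I F) (fun v => bit (z v))).symm
  have h2 := (sum_filter_add_sum_filter_not (C.filter fun v => ¬ v ∈ xverts I F) (fun v => v ∈ privs I N) (fun v => bit (z v))).symm
  have e1 : (C.filter fun v => ¬ v ∈ xverts I F).filter (fun v => v ∈ privs I N) = C.filter (fun v => v ∈ privs I N) := by
    rw [filter_filter]
    refine filter_congr fun v _ => ⟨fun h => h.2, fun h => ⟨not_mem_xverts_of_mem_privs I hT F h, h⟩⟩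
  have e2 : (C.filter fun v => ¬ v ∈ xverts I F).filter (fun v => ¬ v ∈ privs I N) = C.filter (fun v => v ∉ xverts I F ∧ v ∉ privs I N) := by
    rw [filter_filter]
  rw [e1, e2] at h2
  rw [h2] at h1
  have hY : ∑ j ∈ T, (bit (y j) + bit (z (I.vars j 2)) * bit (z (I.vars j 3))) + ∑ j ∈ T, (bit (y j) + bit (z (I.vars j 2)) * bit (z (I.vars j 3))) = 0 := by
    generalize ∑ j ∈ T, (bit (y j) + bit (z (I.vars j 2)) * bit (z (I.vars j 3))) = t; revert t; decide
  linear_combination h1 - hY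

/-- **Under the join condition the XOR reads are the pair sum of the join**, at every point. -/
theorem sum_xverts_eq_pair_sum (I : LocalMap 4 n m) {F T : Finset (Fin m)} {C : Finset (Fin n)}
    (hjoin : ∀ w, Odd (xpdeg I T w) ↔ w ∈ C ∧ w ∈ xverts I F) (x : Fin n → ZMod 2) :
    ∑ v ∈ C.filter (fun v => v ∈ xverts I F), x v = ∑ j ∈ T, (x (I.vars j 0) + x (I.vars j 1)) := by
  classical
  have hset : C.filter (fun v => v ∈ xverts I F) = univ.filter (fun w => Odd (xpdeg I T w)) := by
    ext w
    simp only [mem_filter, mem_univ, true_and, hjoin]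
  rw [hset, ← sum_pair_eq_sum_filter_odd]

/-! ## The second reader -/

/-- **The second reader's bridge data is well formed**: replacing the linear part of the first constraint off the XOR vertices keeps the join. -/
theorem wf_update {I : LocalMap 4 n m} {B : BridgeData n m} (hW : B.WF I) {C₁' : Finset (Fin n)} (b₁' : Bool)
    (hC : ∀ v ∈ B.C₁ ∆ C₁', v ∉ xverts I (B.J₀ \ B.N)) : ({ B with C₁ := C₁', b₁ := b₁' } : BridgeData n m).WF I where
  hN := hW.hN
  hchord := hW.hchord
  hD := hW.hD
  hDeven := hW.hDeven
  hT₁ := hW.hT₁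
  hT₂ := hW.hT₂
  hjoin₁ w := by
    refine (hW.hjoin₁ w).trans ⟨fun h => ⟨?_, h.2⟩, fun h => ⟨?_, h.2⟩⟩
    · by_contra hw
      exact hC w (mem_symmDiff.2 (Or.inl ⟨h.1, hw⟩)) h.2
    · by_contra hw
      exact hC w (mem_symmDiff.2 (Or.inr ⟨h.1, hw⟩)) h.2
  hjoin₂ := hW.hjoin₂
  hcross₁ := hW.hcross₁
  hcross₂ := hW.hcross₂

/-! ## (★★) under the union cover -/

/-- **(★★) for one pair, in instance terms.**  Well-formed liftable bridge data, hun, `w₂` blind on the privates, (T3), and a solution of `J₀ − e` with both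
constraints for the chord `e` ⟹ `u_e(a) = 1` at every base point `a` with `free₂ a = b₂`. -/
theorem forced_of_minimal (I : LocalMap 4 n m) (hI : I.IsPure xorAndPred) (hT : Typed I) {B : BridgeData n m} (hW : B.WF I) (hL : Lift I B)
    (hun : ∀ v ∈ privs I B.N, (∀ g ∈ B.G₁, I.vars g 2 ≠ v ∧ I.vars g 3 ≠ v) ∧ ∀ g ∈ B.G₂, I.vars g 2 ≠ v ∧ I.vars g 3 ≠ v)
    (hblind : ∀ v ∈ privs I B.N, v ∉ B.C₂) (hT3 : ¬ ∃ z, Solution I B B.J₀ z)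
    {e : Fin m} (he : e ∈ B.N) (hmin : ∃ z, Solution I B (B.J₀.erase e) z)
    {a : Fin n → ZMod 2} (ha : free I B.y (B.J₀ \ B.N) B.N B.T₂ B.C₂ B.G₂ a = bit B.b₂) : uval I B.y (B.D e) e a = 1 := by
  have hSR : (sys I B).SingleRead := singleRead_of_untouched I B fun v hv => ⟨hblind v hv, (hun v hv).2⟩
  have hc := const_of_unread I B hun
  have hinf := infeasible_of_not_solution I hI hT hW hL hT3
  obtain ⟨z, hz⟩ := hmin
  have hM := chordMinimal_of_solution_erase I hI hT hW he hz
  have h := (sys I B).star_star hSR hc hinf he hM a (by rw [sys_F, sys_t]; exact ha)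
  rw [sys_u] at h
  exact h

/-- **(★★) under the union cover.**  With the second reader `A₁ = (C₁′, G₁, b₁′)` (linear part equal to `C₁` on the XOR vertices), (T3) for both pairs and the
union cover (M0′) — every output releases one of the two pairs — every chord `e` has `u_e(a) = 1` wherever `free₂ a = b₂`. -/
theorem forced_of_cover (I : LocalMap 4 n m) (hI : I.IsPure xorAndPred) (hT : Typed I) {B : BridgeData n m} (hW : B.WF I) (hL : Lift I B)
    {C₁' : Finset (Fin n)} {b₁' : Bool} (hC : ∀ v ∈ B.C₁ ∆ C₁', v ∉ xverts I (B.J₀ \ B.N))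
    (hun : ∀ v ∈ privs I B.N, (∀ g ∈ B.G₁, I.vars g 2 ≠ v ∧ I.vars g 3 ≠ v) ∧ ∀ g ∈ B.G₂, I.vars g 2 ≠ v ∧ I.vars g 3 ≠ v)
    (hblind : ∀ v ∈ privs I B.N, v ∉ B.C₂)
    (hT3 : ¬ ∃ z, Solution I B B.J₀ z) (hT3' : ¬ ∃ z, Solution I { B with C₁ := C₁', b₁ := b₁' } B.J₀ z)
    (hM0 : ∀ f ∈ B.J₀, (∃ z, Solution I B (B.J₀.erase f) z) ∨ (∃ z, Solution I { B with C₁ := C₁', b₁ := b₁' } (B.J₀.erase f) z))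
    {e : Fin m} (he : e ∈ B.N) {a : Fin n → ZMod 2} (ha : free I B.y (B.J₀ \ B.N) B.N B.T₂ B.C₂ B.G₂ a = bit B.b₂) :
    uval I B.y (B.D e) e a = 1 := by
  rcases hM0 e (hW.hN he) with hmin | hmin
  · exact forced_of_minimal I hI hT hW hL hun hblind hT3 he hmin ha
  · exact forced_of_minimal I hI hT (wf_update hW b₁' hC) hL hun hblind hT3' he hmin ha

/-! ## The reader on `Z(q)` -/

/-- **Infeasibility at the all-ON state.**  If every chord is forced at `a` (`u_e(a) = 1`) and `free₂ a = b₂`, then the reader's state-free part takes the value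
`b₁ + R + 1` at `a`, `R = Σ_{e ∈ N} ([p_e ∈ C₁] + [q_e ∈ C₁])` — the same constant at every such `a`. -/
theorem free₁_of_forced (I : LocalMap 4 n m) (hI : I.IsPure xorAndPred) (hT : Typed I) {B : BridgeData n m} (hW : B.WF I) (hL : Lift I B)
    (hun : ∀ v ∈ privs I B.N, (∀ g ∈ B.G₁, I.vars g 2 ≠ v ∧ I.vars g 3 ≠ v) ∧ ∀ g ∈ B.G₂, I.vars g 2 ≠ v ∧ I.vars g 3 ≠ v)
    (hblind : ∀ v ∈ privs I B.N, v ∉ B.C₂) (hT3 : ¬ ∃ z, Solution I B B.J₀ z)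
    {a : Fin n → ZMod 2} (ha : free I B.y (B.J₀ \ B.N) B.N B.T₂ B.C₂ B.G₂ a = bit B.b₂) (hforced : ∀ e ∈ B.N, uval I B.y (B.D e) e a = 1) :
    free I B.y (B.J₀ \ B.N) B.N B.T₁ B.C₁ B.G₁ a =
      bit B.b₁ + ∑ e ∈ B.N, ((if I.vars e 2 ∈ B.C₁ then (1 : ZMod 2) else 0) + (if I.vars e 3 ∈ B.C₁ then 1 else 0)) + 1 := by
  have hinf := infeasible_of_not_solution I hI hT hW hL hT3
  have hadm : (sys I B).Adm B.N a (fun _ => ((1 : ZMod 2), (1 : ZMod 2))) := fun e he => by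
    rw [sys_u, mul_one]; exact (hforced e he).symm
  have hne := hinf a _ hadm
  rw [val_sys, sys_t] at hne
  have hc1 : ∀ e ∈ B.N, coef I B.C₁ B.G₁ (I.vars e 2) a = (if I.vars e 2 ∈ B.C₁ then 1 else 0) ∧
      coef I B.C₁ B.G₁ (I.vars e 3) a = (if I.vars e 3 ∈ B.C₁ then 1 else 0) := fun e he =>
    ⟨coef_of_unread I (hun _ (vars_mem_privs I he (s := 2) (by decide))).1 a, coef_of_unread I (hun _ (vars_mem_privs I he (s := 3) (by decide))).1 a⟩
  have hc2 : ∀ e ∈ B.N, coef I B.C₂ B.G₂ (I.vars e 2) a = 0 ∧ coef I B.C₂ B.G₂ (I.vars e 3) a = 0 := fun e he => by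
    constructor
    · rw [coef_of_unread I (hun _ (vars_mem_privs I he (s := 2) (by decide))).2 a, if_neg (hblind _ (vars_mem_privs I he (s := 2) (by decide)))]
    · rw [coef_of_unread I (hun _ (vars_mem_privs I he (s := 3) (by decide))).2 a, if_neg (hblind _ (vars_mem_privs I he (s := 3) (by decide)))]
  have e2 : ∀ s R t : ZMod 2, s + R ≠ t → s = t + R + 1 := by decide
  refine e2 _ _ _ fun h1 => hne (Prod.ext ?_ ?_)
  · show free I B.y (B.J₀ \ B.N) B.N B.T₁ B.C₁ B.G₁ a
        + ∑ e ∈ B.N, ((1 : ZMod 2) * coef I B.C₁ B.G₁ (I.vars e 2) a + 1 * coef I B.C₁ B.G₁ (I.vars e 3) a) = bit B.b₁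
    rw [← h1]
    congr 1
    exact sum_congr rfl fun e he => by rw [one_mul, one_mul, (hc1 e he).1, (hc1 e he).2]
  · show free I B.y (B.J₀ \ B.N) B.N B.T₂ B.C₂ B.G₂ a
        + ∑ e ∈ B.N, ((1 : ZMod 2) * coef I B.C₂ B.G₂ (I.vars e 2) a + 1 * coef I B.C₂ B.G₂ (I.vars e 3) a) = bit B.b₂
    rw [sum_eq_zero fun e he => by rw [(hc2 e he).1, (hc2 e he).2, mul_zero, add_zero], add_zero]
    exact ha

/-! ## A genuine solution with all privates on -/

/-- **From a zero of `q` to a solution of `J₀ ∧ w₂` with all privates `1`** (lift the base point, switch every chord ON — admissible because every chord is forced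
on `Z(q)`), agreeing with the base point off the XOR vertices and privates. -/
theorem exists_solution_privs (I : LocalMap 4 n m) (hI : I.IsPure xorAndPred) (hT : Typed I) {B : BridgeData n m} (hW : B.WF I) (hL : Lift I B)
    (hun : ∀ v ∈ privs I B.N, (∀ g ∈ B.G₁, I.vars g 2 ≠ v ∧ I.vars g 3 ≠ v) ∧ ∀ g ∈ B.G₂, I.vars g 2 ≠ v ∧ I.vars g 3 ≠ v)
    (hblind : ∀ v ∈ privs I B.N, v ∉ B.C₂)
    (hforced : ∀ e ∈ B.N, ∀ a, free I B.y (B.J₀ \ B.N) B.N B.T₂ B.C₂ B.G₂ a = bit B.b₂ → uval I B.y (B.D e) e a = 1)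
    {a : Fin n → ZMod 2} (ha : free I B.y (B.J₀ \ B.N) B.N B.T₂ B.C₂ B.G₂ a = bit B.b₂) :
    ∃ z : Fin n → Bool, (∀ j ∈ B.J₀, I.eval z j = B.y j) ∧ gval I B.C₂ B.G₂ z = B.b₂ ∧ (∀ v ∈ privs I B.N, z v = true) ∧
      ∀ v, v ∉ xverts I (B.J₀ \ B.N) → v ∉ privs I B.N → bit (z v) = a v := by
  obtain ⟨z₁, hz₁, hz₁x⟩ := hL fun v => toBool (a v)
  set z : Fin n → Bool := setPriv I B.N (fun _ => (true, true)) z₁ with hz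
  have hzF : ∀ j ∈ B.J₀ \ B.N, I.eval z j = B.y j := fun j hj => by
    rw [hz, eval_setPriv_of_mem_sdiff I hW.hN hW.hchord _ z₁ hj]; exact hz₁ j hj
  have hagree : ∀ v, v ∉ xverts I (B.J₀ \ B.N) → v ∉ privs I B.N → bit (z v) = a v := by
    intro v hvx hvp
    rw [hz, setPriv_of_not_mem I _ z₁ hvp, hz₁x v hvx, bit_toBool]
  have hpriv : ∀ v ∈ privs I B.N, z v = true := by
    intro v hv
    obtain ⟨e, he, h | h⟩ := (mem_privs I).1 hv
    · rw [← h, hz]; exact setPriv_two I hW.hN hW.hchord _ z₁ he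
    · rw [← h, hz]; exact setPriv_three I hI hW.hN hW.hchord _ z₁ he
  have hfree2 : free I B.y (B.J₀ \ B.N) B.N B.T₂ B.C₂ B.G₂ (fun v => bit (z v)) = bit B.b₂ := by
    rw [free_congr I hT hW hW.hT₂ B.C₂ B.G₂ (x := fun v => bit (z v)) (x' := a) fun v h1 h2 => hagree v h1 h2, ha]
  refine ⟨z, fun j hj => ?_, ?_, hpriv, hagree⟩
  · by_cases hjN : j ∈ B.N
    · rw [eval_iff_adm I hI hW hzF hjN, sys_u, hpriv _ (vars_mem_privs I hjN (s := 2) (by decide)),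
        hpriv _ (vars_mem_privs I hjN (s := 3) (by decide)), hforced j hjN _ hfree2]
      decide
    · exact hzF j (mem_sdiff.2 ⟨hj, hjN⟩)
  · apply bit_injective
    rw [bit_gval_eq I hI hT hW.hN hW.hchord B.y hW.hT₂ B.C₂ B.G₂ hW.hjoin₂ hW.hcross₂ hzF, hfree2,
      sum_eq_zero fun e he => ?_, add_zero]
    rw [coef_of_unread I (hun _ (vars_mem_privs I he (s := 2) (by decide))).2, if_neg (hblind _ (vars_mem_privs I he (s := 2) (by decide))),
      coef_of_unread I (hun _ (vars_mem_privs I he (s := 3) (by decide))).2, if_neg (hblind _ (vars_mem_privs I he (s := 3) (by decide))),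
      mul_zero, mul_zero, add_zero]

end Summit.PneNP.PneNP.Theorems.PstarUnionRankSixBridge
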